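import Literature.NumberTheory.Automorphic.Liu2021.AppendixC.AlbaneseTraceIsogeny
import Literature.NumberTheory.Automorphic.Liu2021.AppendixC.HeckeTranslateLevelQuotient
import Literature.NumberTheory.Automorphic.Liu2021.AppendixC.HonestCorrespondencePoints
import HarnessLib

/-!
# The Albanese trace of a LEVEL QUOTIENT `u^N_K : X_N → X_K` of a §4.2 tower — BOTH identities
# `Alb_u ≫ t = Σ_{δ ∈ K∕N} Alb(act δ)` and `t ≫ Alb_u = |K∕N| • 𝟙` (Lang, *Abelian Varieties* VIII §6 Thm. 13; Liu 2021 §4.2)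

Topic `Literature/NumberTheory/Automorphic/Liu2021/AppendixC`; namespace `Literature.NumberTheory.Automorphic.Liu2021.AppendixC`.
PROOF FILE (theorems only; no definition, no named fact, no instance, no `sorry`).  Generic over a §4.2 datum `C : Sec42Data`
([Liu2021] §4.2 l. 2053–2074: the tower `K ↦ X_K` of smooth projective schemes over the reflex field `E` with Albanese data
`α_K : ∇X_K → A_K`, transition morphisms `u^N_K = C.cpt.X.map f` and `Alb_{u^N_K} = C.Atr f`) and, in §3, over Hecke translates
`T : C.HeckeTranslates` with the LEVEL-QUOTIENT UNIVERSAL PROPERTY ([Milne2005ShimuraVarieties] §5 p. 57 «`Sh_K = Sh_{K′}/(K/K′)`»,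
Rem. 5.29 (c); [Deligne1979ShimuraVarieties] 2.7.1 (b)–(c)) in the shape the cell's curve towers deliver it.

WHAT IS ASSEMBLED (everything below is one application of ★ tree theorems):
* ★ `Albanese.exists_trace_comp_eq_card_smul_of_isSepQuotient` (`AppendixC/AlbaneseTraceIsogeny.lean`): for `k` of characteristic
  zero, a finite group `Δ` acting on the smooth projective `X` with quotient `p : X ⟶ Y` for separated test objects (`Y` smooth
  projective) and Albanese data `aX`, `aY`, there is `t : Alb_Y ⟶ Alb_X` with `Alb_p ≫ t = Σ_g Alb_{act g}` AND `t ≫ Alb_p = |Δ| • 𝟙`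
  (Lang's `h_* f_* = Σ g_*`, `f_* h_* = m·δ`);
* ★ `Sec42Data.Atr_eq_map` (`AppendixC/AlbaneseFunctorial.lean`): the posited transition `Alb_{u^N_K} = C.Atr f` IS `Albanese.map` at
  `u^N_K` (Def. 2.3 leaves no freedom), and `C.cpt.smooth_X`, `C.cpt.projective_X` (Def. C.8: the `X_K` are smooth projective);
* ★ `isSepQuotient_quotientLift` ∕ ★ `HeckeTranslates.exists_finite_isSepQuotient_map'` (`AppendixC/HeckeTranslateLevelQuotient.lean`):
  a quotient by `Γ` is a quotient by the FINITE `Γ ∕ N′` when `N′` acts trivially; `u^N_K` is the quotient of `X_N` by the finite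
  group `K ∕ N` acting through the translates `T_{k⁻¹}`, granted the level-quotient universal property.

RESULTS:
* §1 `Sec42Data.exists_albaneseTrace_of_isSepQuotient` — for ANY finite group `Δ` of automorphisms of `X_N` with `u^N_K` its quotient
  for separated test objects: `∃ t : A_K ⟶ A_N`, `act δ ≫ u = u` (all `δ`) ∧ `Alb_u ≫ t = Σ_δ Alb(act δ)` ∧ `t ≫ Alb_u = |Δ| • 𝟙_{A_K}`.
* §2 `Sec42Data.exists_albaneseTrace_of_isSepQuotient_quotient` — the same for an action of ANY group `Γ` trivial on a normal subgroup
  `N′` of finite index, through `Γ ∕ N′` (the shape `act : ↥K →* Aut M⋆_N` of the record towers' `IsLevelQuotient`, where the level `N`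
  acts trivially); `Sec42Data.exists_albaneseTrace_of_isSepQuotient_level` — specialised to `Γ = ↥K`, `N′ = N ∩ K` (`K ∕ N` finite because
  `K` is compact and `N` open), output in the «`∃ Δ, Fintype Δ, act : Δ → End X_N, t`» currency with `0 < |Δ|` and every `act δ` one
  of the given automorphisms.
* §3 `Sec42Data.HeckeTranslates.exists_albaneseTrace_of_levelQuotientUP` — from the level-quotient universal property for `N ≤ K`,
  `N ⊴ K`: `∃ (Δ) (Fintype Δ) (act : Δ → End X_N) (t : A_K ⟶ A_N)`, `act δ ≫ u = u` ∧ `Alb_u ≫ t = Σ_δ Alb(act δ)` ∧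
  `t ≫ Alb_u = |Δ| • 𝟙` ∧ `0 < |Δ|` — VERBATIM the body of the D9op road-2′ letter `RecordCurveAlbaneseTrace` (cell `hodgecm-mathlib`,
  crux `HLiu418` = stmt-HodgeConjecture-24832, line `Cruxes/HLiu418/Lines/F0_D9opRoad2.lean` ed. 4, `stub_C1b`; F0P5a-p02 hand-back memo
  §1), whose first conjunct feeds ★ `IsSepQuotient`-invariance into the composition, whose second is the hypothesis `ht` of the honest
  correspondence on points ★ `HeckeTranslates.comp_nablaTr_comp_α_comp_trace_sum_albTr`, and whose third is the `htr` of the pole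
  `stub_C`; `…_levelQuotientUP'` keeps the translate description of the action (every `act δ` is a `T_k`, `k ∈ K`, and conversely).
  At the record curve `M⋆` the universal property is ★ `levelQuotientUP_GSM` (from u4 `IsLevelQuotient`), so the letter closes in one line.

HC_CM is proved only modulo the 7 printed citations until rung 0 closes; nothing of [Liu2021] is asserted here.  Ours (formalisation
glue); axioms `propext`, `Classical.choice`, `Quot.sound`.

## References
* [Lang1983AbelianVarieties] S. Lang, *Abelian Varieties* (Springer 1983 reprint of the 1959 edition), Ch. VIII §6 Thm. 13 and its
  proof (pp. 224–227: `h_*` with `h_* f_* = Σ σ_*`, `f_* h_* = m·δ_{A(V)}`).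
* [Liu2021] Y. Liu, *Fourier–Jacobi cycles and arithmetic relative trace formula*, Camb. J. Math. 9 (2021) = arXiv:2102.11518: Def. 2.3
  (FJcycle.tex l. 1202–1208), §4.2 (l. 2053–2074), App. C Def. C.8 (l. 4663–4665).
* [Milne2005ShimuraVarieties] J. S. Milne, *Introduction to Shimura varieties* (2005), §5 p. 57 L7–12, Rem. 5.29 (c) p. 65.
* [Deligne1979ShimuraVarieties] P. Deligne, *Variétés de Shimura*, Proc. Symp. Pure Math. 33 (1979), 2.7.1 (b)–(c).
* [MumfordAV1970] D. Mumford, *Abelian Varieties* (1970), §7 Thm. p. 66 and Remark.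
-/

set_option autoImplicit false

noncomputable section

open CategoryTheory AlgebraicGeometry NumberField
open Literature.AlgebraicGeometry.Motives

namespace Literature.NumberTheory.Automorphic.Liu2021.AppendixC

open scoped MonObj

universe v

section Sec42

variable {F E : Type} [Field F] [NumberField F] [IsTotallyReal F] [Field E] [NumberField E] [Algebra F E]
  [IsTotallyComplex E] [Algebra.IsQuadraticExtension F E]
variable {P5 : PropC5Data F E} {isotropicAt : ℕ → Prop}

namespace Sec42Data

variable (C : Sec42Data P5 isotropicAt)

/-! ## §1 Both trace identities for a finite quotient `u^N_K = X_N → X_N ∕ Δ = X_K` of the tower -/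

/-- **The Albanese trace of a finite level quotient, both identities** (Lang VIII §6 Thm. 13 at the §4.2 datum).  Let `f : N ⟶ K` be
levels of a §4.2 datum `C` (`u := C.cpt.X.map f : X_N → X_K`, `Alb_u := C.Atr f : A_N → A_K`) and let a FINITE group `Δ` act on `X_N` by
`E`-automorphisms `act` so that `u` is the quotient of `X_N` by `Δ` for separated test objects (`Motives.IsSepQuotient`).  Then there is
`t : A_K ⟶ A_N` (Lang's `h_*`) with: every `act δ` is a deck transformation (`act δ ≫ u = u`), `Alb_u ≫ t = Σ_{δ ∈ Δ} Alb(act δ)`, and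
`t ≫ Alb_u = |Δ| • 𝟙_{A_K}`.  PROOF: `X_N`, `X_K` are smooth projective over the number field `E` (Def. C.8, `C.cpt.smooth_X ∕ projective_X`),
`Alb_u = Albanese.map u` (★ `Sec42Data.Atr_eq_map`), and ★ `Albanese.exists_trace_comp_eq_card_smul_of_isSepQuotient`.
[cite: Lang1983AbelianVarieties, Ch. VIII §6 Thm. 13 (pp. 224–227)] [cite: Liu2021, Def. 2.3 (FJcycle.tex l. 1206–1208) and §4.2 (l. 2062–2070)]
[cite: MumfordAV1970, §7 Thm. p. 66] -/
theorem exists_albaneseTrace_of_isSepQuotient {N K : C5.SmallLevel C.S.K₀} (f : N ⟶ K)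
    {Δ : Type v} [Group Δ] [Fintype Δ] (act : Δ →* Aut (C.X N))
    (hq : IsSepQuotient (fun δ => act δ) (C.cpt.X.map f)) :
    ∃ t : C.A K ⟶ C.A N,
      (∀ δ, (act δ).hom ≫ C.cpt.X.map f = C.cpt.X.map f) ∧
      C.Atr f ≫ t = ∑ δ, (C.alb N).map (C.alb N) (act δ).hom ∧
      t ≫ C.Atr f = (Fintype.card Δ : ℤ) • 𝟙 (C.A K) := by
  haveI := C.cpt.smooth_X N
  haveI := C.cpt.smooth_X K
  obtain ⟨t, ht, htr⟩ := Albanese.exists_trace_comp_eq_card_smul_of_isSepQuotient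
    (dX := P5.n - 1) (dY := P5.n - 1) (C.cpt.projective_X N) (C.cpt.projective_X K) act (C.cpt.X.map f) hq
    (C.alb N) (C.alb K)
  refine ⟨t, hq.1, ?_, ?_⟩
  · rw [C.Atr_eq_map f]
    exact ht
  · rw [C.Atr_eq_map f]
    exact htr

/-! ## §2 Through a finite quotient `Γ ∕ N′` of the acting group (the `IsLevelQuotient` shape: `K` acts on `X_N`, `N` trivially) -/

/-- **Both trace identities through the finite quotient `Γ ∕ N′` of the acting group.**  If ANY group `Γ` acts on `X_N` by
`act : Γ →* Aut X_N` with `u = C.cpt.X.map f` its quotient for separated test objects, and a normal subgroup `N′ ⊴ Γ` of finite index acts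
trivially (`act n = 1`, `n ∈ N′`), then for the induced action `act' := QuotientGroup.lift N′ act` of the finite group `Γ ∕ N′` (any
`Fintype` structure) there is `t : A_K ⟶ A_N` with `act' δ ≫ u = u`, `Alb_u ≫ t = Σ_{δ ∈ Γ∕N′} Alb(act' δ)` and `t ≫ Alb_u = |Γ ∕ N′| • 𝟙`.
(The universal property only sees the set `{act g}`: ★ `isSepQuotient_quotientLift`.)  This is the shape in which the curve records
deliver `M⋆_K = M⋆_N ∕ (K∕N)` (`IsLevelQuotient`: `K` acts on `M⋆_N` by the translates `T_{k⁻¹}`, `T_n = 𝟙` for `n ∈ N`).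
[cite: Lang1983AbelianVarieties, Ch. VIII §6 Thm. 13 (pp. 224–227)] [cite: Milne2005ShimuraVarieties, Rem. 5.29 (c) p. 65]
[cite: Deligne1979ShimuraVarieties, 2.7.1 (b)–(c)] [cite: MumfordAV1970, §7 Thm. p. 66 (Remark)] -/
theorem exists_albaneseTrace_of_isSepQuotient_quotient {N K : C5.SmallLevel C.S.K₀} (f : N ⟶ K)
    {Γ : Type v} [Group Γ] (act : Γ →* Aut (C.X N)) (hq : IsSepQuotient (fun g => act g) (C.cpt.X.map f))
    (N' : Subgroup Γ) [N'.Normal] (hker : ∀ n ∈ N', act n = 1) [Fintype (Γ ⧸ N')] :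
    ∃ t : C.A K ⟶ C.A N,
      (∀ δ : Γ ⧸ N', (QuotientGroup.lift N' act hker δ).hom ≫ C.cpt.X.map f = C.cpt.X.map f) ∧
      C.Atr f ≫ t = ∑ δ : Γ ⧸ N', (C.alb N).map (C.alb N) (QuotientGroup.lift N' act hker δ).hom ∧
      t ≫ C.Atr f = (Fintype.card (Γ ⧸ N') : ℤ) • 𝟙 (C.A K) :=
  C.exists_albaneseTrace_of_isSepQuotient f (QuotientGroup.lift N' act hker) (isSepQuotient_quotientLift N' act hker hq)

/-- **Both trace identities for a level quotient `u^N_K`, from an action of `↥K` on `X_N` trivial on `N`** (the output shape of the curve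
records' `IsLevelQuotient` at `N ≤ K`, `N ⊴ K`): if `act : ↥K →* Aut X_N` makes `u^N_K = C.cpt.X.map (homOfLE hNK)` the quotient of `X_N`
for separated test objects and `act k = 1` whenever `k ∈ N`, then — `K ∕ N` being FINITE (`K` compact, `N` open) — there are a finite type
`Δ` (namely `↥K ∕ (N ∩ K)`), a family `act' : Δ → End(X_N)` each member of which is one of the `act k` and a deck transformation of `u^N_K`,
and `t : A_K ⟶ A_N` with `Alb_u ≫ t = Σ_δ Alb(act' δ)`, `t ≫ Alb_u = |Δ| • 𝟙_{A_K}`, `0 < |Δ|`.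
[cite: Lang1983AbelianVarieties, Ch. VIII §6 Thm. 13 (pp. 224–227)] [cite: Milne2005ShimuraVarieties, §5 p. 57 L7–12 and Rem. 5.29 (c) p. 65]
[cite: Deligne1979ShimuraVarieties, 2.7.1 (b)–(c)] -/
theorem exists_albaneseTrace_of_isSepQuotient_level ⦃N K : C5.SmallLevel C.S.K₀⦄ (hNK : N ≤ K)
    (hn : ∀ k ∈ K.1.1, ∀ n ∈ N.1.1, k⁻¹ * n * k ∈ N.1.1)
    (act : ↥K.1.1 →* Aut (C.X N)) (hq : IsSepQuotient (fun k => act k) (C.cpt.X.map (homOfLE hNK)))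
    (hker : ∀ k : ↥K.1.1, (k : C.G) ∈ N.1.1 → act k = 1) :
    ∃ (Δ : Type) (_ : Fintype Δ) (act' : Δ → (C.X N ⟶ C.X N)) (t : C.A K ⟶ C.A N),
      (∀ δ, ∃ k : ↥K.1.1, act' δ = (act k).hom) ∧
      (∀ δ, act' δ ≫ C.cpt.X.map (homOfLE hNK) = C.cpt.X.map (homOfLE hNK)) ∧
      C.Atr (homOfLE hNK) ≫ t = ∑ δ, (C.alb N).map (C.alb N) (act' δ) ∧
      t ≫ C.Atr (homOfLE hNK) = (Fintype.card Δ : ℤ) • 𝟙 (C.A K) ∧ 0 < Fintype.card Δ := by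
  classical
  let Kg : Subgroup C.G := K.1.1
  let Ng : Subgroup ↥Kg := N.1.1.subgroupOf K.1.1
  have hmemNg : ∀ x : ↥Kg, x ∈ Ng ↔ (x : C.G) ∈ N.1.1 := fun x => Subgroup.mem_subgroupOf
  haveI hNn : Ng.Normal := ⟨fun n hn' g => by
    rw [hmemNg] at hn' ⊢
    have h1 := hn (g⁻¹ : ↥Kg) (g⁻¹).2 _ hn'
    simpa only [Subgroup.coe_inv, inv_inv, Subgroup.coe_mul] using h1⟩
  haveI : CompactSpace ↥Kg := isCompact_iff_compactSpace.1 K.1.2.2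
  have hNo : IsOpen (Ng : Set ↥Kg) := N.1.2.1.preimage continuous_subtype_val
  haveI : Finite (↥Kg ⧸ Ng) := Subgroup.quotient_finite_of_isOpen Ng hNo
  letI : Fintype (↥Kg ⧸ Ng) := Fintype.ofFinite _
  have hker' : ∀ n ∈ Ng, act n = 1 := fun n hn' => hker n ((hmemNg n).1 hn')
  obtain ⟨t, hinv, ht, htr⟩ := C.exists_albaneseTrace_of_isSepQuotient_quotient (homOfLE hNK) act hq Ng hker'
  refine ⟨↥Kg ⧸ Ng, inferInstance, fun δ => (QuotientGroup.lift Ng act hker' δ).hom, t, fun δ => ?_, hinv, ht, htr,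
    Fintype.card_pos⟩
  obtain ⟨k, rfl⟩ := QuotientGroup.mk_surjective δ
  exact ⟨k, rfl⟩

namespace HeckeTranslates

variable {C} (T : C.HeckeTranslates)

/-! ## §3 From the level-quotient universal property (Hecke translates): the letter `RecordCurveAlbaneseTrace` generically -/

/-- **The Albanese trace of the level quotient `u^N_K : X_N → X_K`, both identities, from the level-quotient universal property** —
the body of the D9op road-2′ letter `RecordCurveAlbaneseTrace` over a generic §4.2 datum with Hecke translates: for `N ≤ K` with `N`
normalised by `K` (`hn`), if every morphism `X_N → W` to a separated `W` invariant under the translates `T_k` (`k ∈ K`) factors uniquely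
through `u^N_K` (`hUP`; [Milne2005ShimuraVarieties] §5 «`Sh_K = Sh_{K′}/(K/K′)`»), then there are a finite type `Δ` (`= K ∕ N`), a family
`act : Δ → End(X_N)` (the translates `T_{k⁻¹}`, `k` running over coset representatives) and `t : A_K ⟶ A_N` such that
`act δ ≫ u^N_K = u^N_K` (all `δ`), `Alb_{u^N_K} ≫ t = Σ_δ Alb(act δ)`, `t ≫ Alb_{u^N_K} = |Δ| • 𝟙_{A_K}` and `0 < |Δ|`.
ASSEMBLY: ★ `exists_finite_isSepQuotient_map'` (the finite group `K ∕ N` and its action) + §1.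
[cite: Lang1983AbelianVarieties, Ch. VIII §6 Thm. 13 (pp. 224–227)] [cite: Milne2005ShimuraVarieties, §5 p. 57 L7–12, p. 58 L3–11 and Rem. 5.29 (c) p. 65]
[cite: Deligne1979ShimuraVarieties, 2.7.1 (b)–(c)] [cite: Liu2021, §4.2 (FJcycle.tex l. 2062–2070) and Def. 2.3 (l. 1206–1208)] -/
theorem exists_albaneseTrace_of_levelQuotientUP ⦃N K : C5.SmallLevel C.S.K₀⦄ (hNK : N ≤ K)
    (hn : ∀ k ∈ K.1.1, C5.HeckeLE k N N)
    (hUP : ∀ (W : SchemeOver E) (f : C.X N ⟶ W), IsSeparated W.hom →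
      (∀ (k : C.G) (hk : k ∈ K.1.1), T.tr k N N (hn k hk) ≫ f = f) →
        ∃! fbar : C.X K ⟶ W, C.cpt.X.map (homOfLE hNK) ≫ fbar = f) :
    ∃ (Δ : Type) (_ : Fintype Δ) (act : Δ → (C.X N ⟶ C.X N)) (t : C.A K ⟶ C.A N),
      (∀ δ, act δ ≫ C.cpt.X.map (homOfLE hNK) = C.cpt.X.map (homOfLE hNK)) ∧
      C.Atr (homOfLE hNK) ≫ t = ∑ δ, (C.alb N).map (C.alb N) (act δ) ∧
      t ≫ C.Atr (homOfLE hNK) = (Fintype.card Δ : ℤ) • 𝟙 (C.A K) ∧ 0 < Fintype.card Δ := by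
  obtain ⟨Δ, _instG, _instF, act, -, -, hq⟩ := T.exists_finite_isSepQuotient_map' hNK hn hUP
  obtain ⟨t, hinv, ht, htr⟩ := C.exists_albaneseTrace_of_isSepQuotient (homOfLE hNK) act hq
  exact ⟨Δ, inferInstance, fun δ => (act δ).hom, t, hinv, ht, htr, Fintype.card_pos⟩

/-- **The same with the translate description of the action kept** (the `hact` binder of the piecewise trace words and of
★ `heckeEnd_eq_pushPull_of_aut`): every `act δ` is a translate `T_k`, `k ∈ K`, and every `T_k`, `k ∈ K`, occurs as some `act δ`.
[cite: Lang1983AbelianVarieties, Ch. VIII §6 Thm. 13 (pp. 224–227)] [cite: Milne2005ShimuraVarieties, §5 p. 57 L7–12 and Rem. 5.29 (c) p. 65]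
[cite: Deligne1979ShimuraVarieties, 2.7.1 (b)–(c)] -/
theorem exists_albaneseTrace_of_levelQuotientUP' ⦃N K : C5.SmallLevel C.S.K₀⦄ (hNK : N ≤ K)
    (hn : ∀ k ∈ K.1.1, C5.HeckeLE k N N)
    (hUP : ∀ (W : SchemeOver E) (f : C.X N ⟶ W), IsSeparated W.hom →
      (∀ (k : C.G) (hk : k ∈ K.1.1), T.tr k N N (hn k hk) ≫ f = f) →
        ∃! fbar : C.X K ⟶ W, C.cpt.X.map (homOfLE hNK) ≫ fbar = f) :
    ∃ (Δ : Type) (_ : Fintype Δ) (act : Δ → (C.X N ⟶ C.X N)) (t : C.A K ⟶ C.A N),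
      (∀ δ, ∃ (k : C.G) (hk : k ∈ K.1.1), act δ = T.tr k N N (hn k hk)) ∧
      (∀ (k : C.G) (hk : k ∈ K.1.1), ∃ δ, act δ = T.tr k N N (hn k hk)) ∧
      (∀ δ, act δ ≫ C.cpt.X.map (homOfLE hNK) = C.cpt.X.map (homOfLE hNK)) ∧
      C.Atr (homOfLE hNK) ≫ t = ∑ δ, (C.alb N).map (C.alb N) (act δ) ∧
      t ≫ C.Atr (homOfLE hNK) = (Fintype.card Δ : ℤ) • 𝟙 (C.A K) ∧ 0 < Fintype.card Δ := by
  obtain ⟨Δ, _instG, _instF, act, hact₁, hact₂, hq⟩ := T.exists_finite_isSepQuotient_map' hNK hn hUP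
  obtain ⟨t, hinv, ht, htr⟩ := C.exists_albaneseTrace_of_isSepQuotient (homOfLE hNK) act hq
  exact ⟨Δ, inferInstance, fun δ => (act δ).hom, t, hact₁, hact₂, hinv, ht, htr, Fintype.card_pos⟩

/-- **The honest correspondence on difference points WITH ITS TRACE SUPPLIED** (★ `comp_nablaTr_comp_α_comp_trace_sum_albTr` with the
binders `act`, `t`, `ht` discharged by `exists_albaneseTrace_of_levelQuotientUP`): granted the level-quotient universal property at
`N ≤ K`, `N ⊴ K`, there are `Δ`, `act`, `t` as there such that, for all translates `T_{g_i}` defined at `N → K` and every `z : W ⟶ ∇X_N`,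
`z ≫ ∇u ≫ α_K ≫ (t ≫ Σ_{i ∈ s} Alb(T_{g_i})) = ∏_δ ∏_{i ∈ s} z ≫ ∇(act δ) ≫ ∇(T_{g_i}) ≫ α_K` in the group `A_K(W)` — on `Ω`-points:
`𝒯(α_K(u x̃, u ỹ)) = Σ_{δ,i} α_K(T_{g_i} δ x̃, T_{g_i} δ ỹ)` for the trace-scaled honest correspondence `𝒯 = t ≫ Σ_i Alb(T_{g_i})`, with
`t ≫ Alb_u = |Δ| • 𝟙`. [cite: Liu2021, Def. 2.3 (FJcycle.tex l. 1206–1208) and §4.2 (l. 2070–2074)]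
[cite: Lang1983AbelianVarieties, Ch. VIII §6 Thm. 13 (pp. 224–227)] [cite: Milne2005ShimuraVarieties, §5 p. 58] -/
theorem exists_albaneseTrace_comp_nablaTr_comp_α_comp_trace_sum_albTr ⦃N K : C5.SmallLevel C.S.K₀⦄ (hNK : N ≤ K)
    (hn : ∀ k ∈ K.1.1, C5.HeckeLE k N N)
    (hUP : ∀ (W : SchemeOver E) (f : C.X N ⟶ W), IsSeparated W.hom →
      (∀ (k : C.G) (hk : k ∈ K.1.1), T.tr k N N (hn k hk) ≫ f = f) →
        ∃! fbar : C.X K ⟶ W, C.cpt.X.map (homOfLE hNK) ≫ fbar = f) :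
    ∃ (Δ : Type) (_ : Fintype Δ) (act : Δ → (C.X N ⟶ C.X N)) (t : C.A K ⟶ C.A N),
      (∀ δ, act δ ≫ C.cpt.X.map (homOfLE hNK) = C.cpt.X.map (homOfLE hNK)) ∧
      C.Atr (homOfLE hNK) ≫ t = ∑ δ, (C.alb N).map (C.alb N) (act δ) ∧
      t ≫ C.Atr (homOfLE hNK) = (Fintype.card Δ : ℤ) • 𝟙 (C.A K) ∧ 0 < Fintype.card Δ ∧
      ∀ {I : Type} (s : Finset I) (g : I → C.G) (hg : ∀ i, C5.HeckeLE (g i) N K)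
        {W : SchemeOver E} (z : W ⟶ (C.alb N).nabla.N),
        z ≫ C.nablaTr (homOfLE hNK) ≫ (C.alb K).α ≫ (t ≫ ∑ i ∈ s, T.albTr (g i) N K (hg i)).hom.hom.hom =
          ∏ δ, ∏ i ∈ s, z ≫ (C.alb N).nabla.map (C.alb N).nabla (act δ) ≫
            (C.alb N).nabla.map (C.alb K).nabla (T.tr (g i) N K (hg i)) ≫ (C.alb K).α := by
  obtain ⟨Δ, instF, act, t, hinv, ht, htr, hpos⟩ := T.exists_albaneseTrace_of_levelQuotientUP hNK hn hUP
  exact ⟨Δ, instF, act, t, hinv, ht, htr, hpos, fun s g hg _ z =>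
    T.comp_nablaTr_comp_α_comp_trace_sum_albTr (homOfLE hNK) act t ht s g hg z⟩

end HeckeTranslates

end Sec42Data

end Sec42

end Literature.NumberTheory.Automorphic.Liu2021.AppendixC

end
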